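import Literature.Probability.RandomPlanarGeometry.HexSAWSurfaceWallRenewalSlackFourFourDown
import Literature.Probability.RandomPlanarGeometry.HexSAWSurfaceWallRenewalSlackFourFourDownSystems
import Literature.Probability.RandomPlanarGeometry.HexSAWSurfaceWallRenewalSlackFourFourDownIntTableDDDDUUUU
import Literature.Probability.RandomPlanarGeometry.HexSAWSurfaceWallRenewalSlackFourFourDownIntTableDDDUDUUU
import Literature.Probability.RandomPlanarGeometry.HexSAWSurfaceWallRenewalSlackFourFourDownIntTableDDDUUDUU
import Literature.Probability.RandomPlanarGeometry.HexSAWSurfaceWallRenewalSlackFourFourDownIntTableDDUDDUUU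
import Literature.Probability.RandomPlanarGeometry.HexSAWSurfaceWallRenewalSlackFourFourDownIdentDeep
import Literature.Probability.RandomPlanarGeometry.HexSAWSurfaceWallRenewalSlackFourFourDownIdentShallow
import Literature.Probability.RandomPlanarGeometry.HexSAWSurfaceWallRenewalSlackFourFourDownReturnSystem
import HarnessLib

/-!
# Hexagonal-lattice SAWs at a surface: slack four — the exact four-down law and the exact slack-four row

Irreducible positive wall bridges (`ipwb m`, the wall renewal blocks of the brick-wall = hexagonal half-plane walk)
of length `m = 6k + 4` with `k` surface visits — slack four — and exactly four down steps. The chain closes here: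
the five orders (`four_down_slack_four`, `…SlackFourFourDown`), the runs, the constraint systems
(`…SlackFourFourDownSystems`, `…SlackFourFourDownReturnSystem`), the integer tables (`…IntTableDDDDUUUU`,
`…DDDUDUUU`, `…DDDUUDUU`, `…DDUDDUUU`, `…ReturnHyp`) and the identification with the table walks (`…IdentDeep`,
`…IdentShallow`, `…ReturnSystem`) place every such block in `ddddBlocks k` (`…SlackFourFourDownCount`), whose
cardinality and floor are known there:

* `four_down_mem_ddddBlocks` — ★★ the classification: every block of the four-down stratum at slack four is one of
  the table walks of the sixteen families A7 – A15, B5.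

* `twelve_mul_card_filter_visits_four_down` — ★★★ the exact four-down law
  `12 · #{ω ∈ ipwb (6k+4) : visits = k, #stepsD = 4} = (k − 2)(2k⁴ − 7k³ + 4k² + 7k + 6)` (`k ≥ 2`;
  `0, 3, 27, 129, 424, 1105, 2463, …`).

* `twelve_mul_card_filter_visits_slack_four` — ★★★★ the exact slack-four row of the surface renewal table:
  `12 · N(6k+4, k) = 2k⁵ − 11k⁴ + 30k³ + 5k² − 38k + 60` (`k ≥ 2`; `N = 11, 33, 95, 260, 649, 1461, 2993, …`), from
  the four-down law and the census of at most three down steps `two_mul_card_filter_visits_slack_four`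
  (`…SlackFourRow`).

STATUS: lane theorems of the a-idea-1 bridge/renewal lineage, car 101 «the four-down law» — closes
FINDING-HEX-WALL-SLACK-FOUR-LAW (the floor `slack_four_quintic_floor` of `…SlackFourFourDownCount` becomes
an equality). OURS (elementary): the fourth rung, after the one-, two- and three-down laws, of the exact
renewal structure behind the critical surface fugacity `1 + √2` of the honeycomb lattice. Sources: the
renewal / irreducible-bridge structure [MS] Madras–Slade §4.2 (Definition 4.2.1, p. 90; (4.2.2); remark
before (4.2.21), p. 94), the critical fugacity [BBDDG] Beaton–Bousquet-Mélou–de Gier–Duminil-Copin–Guttmann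
§3.1, the brick-wall frame [EJ] Enting–Jensen §7.4.2, Fig. 7.10 — none states these laws. No
`set_option maxHeartbeats` line is used.
-/

namespace Literature.Probability.RandomPlanarGeometry.SAW.HexBW.Wall

open Finset Filter Function
open Literature.Probability.LatticeModels Literature.Probability.Percolation SimpleGraph

variable {ω : ℕ → Site 2}

/-- ★★ **Classification of the four-down stratum at slack four.** For `k ≥ 2`, an irreducible positive wall bridge
of length `6k + 4` with `k` surface visits and exactly four down steps is one of the `(k−2)(2k⁴−7k³+4k²+7k+6)/12`
table walks of `ddddBlocks k` (families A7 – A10 for the order `D D D D U U U U`, A11 – A12 for `D D D U D U U U`,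
A13 for `D D D U U D U U`, A14 – A15 for `D D U D D U U U`, B5 for the wall-return order `D D U U D D U U`). Proof:
`four_down_slack_four` separates the five orders; per order the runs (`…4_runs`), the system (`…4_hyp`), the integer
table (`…4_int_table`) and the identification (`…4_eq_s4a` … `…4_eq_s4j`, then `s4j_mem_ddddBlocks` for B5). OURS —
the hexagonal-lattice analogue of enumerating irreducible bridges by their dives.
[cite: MadrasSlade1993, §4.2, Definition 4.2.1 (p. 90), remark before (4.2.21) (p. 94)]
[cite: EntingJensen2009, §7.4.2, Fig. 7.10] -/
theorem four_down_mem_ddddBlocks {k m : ℕ} (hk : 2 ≤ k) (hm : m = 6 * k + 4) (hω : ω ∈ ipwb m) (hv : visits m ω = k)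
    (hcD : #(stepsD m ω) = 4) : ω ∈ ddddBlocks k := by
  classical
  obtain
      ⟨p₁, p₂, p₃, p₄, r₁, r₂, r₃, r₄, hD, hU, h12, h23, h34, hr12, hr23, hr34, -, -, -, -, hp1, -, hR0, hP1x, hP1y,
          hhor,
      hord⟩ := four_down_slack_four hk hm hω hv hcD
  obtain ⟨hpw, -, -⟩ := mem_ipwb.1 hω
  have hs : ω ∈ saws m := saws_of_mem_pwb hpw
  rcases hord with ht4 | ⟨ht3, ht4, ht5⟩ | ⟨ht3, ht5, ht6⟩ | ⟨ht2, ht3, ht5⟩ | ⟨ht2, ht4, ht6⟩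
  · -- `D D D D U U U U`: families A7, A8, A9, A10
    obtain ⟨e₁, e₂, e₃, e₄, e₅, e₆, e₇, he₁, he₂, he₃, he₄, he₅, he₆, he₇, hrun1, hrun2, hrun3, hrun4, hrun5,
        hrun6, hrun7, hR8, -⟩ :=
      dddduuuu4_runs hm hω hv hD hU h12 h23 h34 hr12 hr23 hr34 ht4 hp1 hR0 hP1x hP1y hhor
    obtain ⟨c1, c2, c3, c4, c5, c6, c7, hC1, hC2, hC3, hC4, hC5, hC6, hC7, -, H⟩ :=
      dddduuuu4_hyp hk hm hω hv hD hU h12 h23 h34 hr12 hr23 hr34 ht4 hp1 hR0 hP1x hP1y hhor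
    rcases dddduuuu4_int_table H with hF | hF | hF | hF
    · exact
        (dddduuuu4_eq_s4a hm hs hR0 he₁ he₂ he₃ he₄ he₅ he₆ he₇ hrun1 hrun2 hrun3 hrun4 hrun5 hrun6 hrun7 hR8 hC1 hC2
            hC3 hC4 hC5 hC6 hC7
        H rfl rfl rfl rfl rfl rfl rfl rfl rfl hF).1
    · exact
        (dddduuuu4_eq_s4b hm hs hR0 he₁ he₂ he₃ he₄ he₅ he₆ he₇ hrun1 hrun2 hrun3 hrun4 hrun5 hrun6 hrun7 hR8 hC1 hC2
            hC3 hC4 hC5 hC6 hC7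
        H rfl rfl rfl rfl rfl rfl rfl rfl rfl hF).1
    · exact
        (dddduuuu4_eq_s4c hm hs hR0 he₁ he₂ he₃ he₄ he₅ he₆ he₇ hrun1 hrun2 hrun3 hrun4 hrun5 hrun6 hrun7 hR8 hC1 hC2
            hC3 hC4 hC5 hC6 hC7
        H rfl rfl rfl rfl rfl rfl rfl rfl rfl hF).1
    · exact
        (dddduuuu4_eq_s4d hm hs hR0 he₁ he₂ he₃ he₄ he₅ he₆ he₇ hrun1 hrun2 hrun3 hrun4 hrun5 hrun6 hrun7 hR8 hC1 hC2
            hC3 hC4 hC5 hC6 hC7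
        H rfl rfl rfl rfl rfl rfl rfl rfl rfl hF).1
  · -- `D D D U D U U U`: families A11, A12
    obtain ⟨e₁, e₂, e₃, e₄, e₅, e₆, e₇, he₁, he₂, he₃, he₄, he₅, he₆, he₇, hrun1, hrun2, hrun3, hrun4, hrun5,
        hrun6, hrun7, hR8, -⟩ :=
      ddduduuu4_runs hm hω hv hD hU h12 h23 h34 hr12 hr23 hr34 ht3 ht4 ht5 hp1 hR0 hP1x hP1y hhor
    obtain ⟨c1, c2, c3, c4, c5, c6, c7, hC1, hC2, hC3, hC4, hC5, hC6, hC7, -, H⟩ :=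
      ddduduuu4_hyp hk hm hω hv hD hU h12 h23 h34 hr12 hr23 hr34 ht3 ht4 ht5 hp1 hR0 hP1x hP1y hhor
    rcases ddduduuu4_int_table H with hF | hF
    · exact
        (ddduduuu4_eq_s4e hm hs hR0 he₁ he₂ he₃ he₄ he₅ he₆ he₇ hrun1 hrun2 hrun3 hrun4 hrun5 hrun6 hrun7 hR8 hC1 hC2
            hC3 hC4 hC5 hC6 hC7
        H rfl rfl rfl rfl rfl rfl rfl rfl rfl hF).1
    · exact
        (ddduduuu4_eq_s4f hm hs hR0 he₁ he₂ he₃ he₄ he₅ he₆ he₇ hrun1 hrun2 hrun3 hrun4 hrun5 hrun6 hrun7 hR8 hC1 hC2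
            hC3 hC4 hC5 hC6 hC7
        H rfl rfl rfl rfl rfl rfl rfl rfl rfl hF).1
  · -- `D D D U U D U U`: family A13
    obtain ⟨e₁, e₂, e₃, e₄, e₅, e₆, e₇, he₁, he₂, he₃, he₄, he₅, he₆, he₇, hrun1, hrun2, hrun3, hrun4, hrun5,
        hrun6, hrun7, hR8, -⟩ :=
      ddduuduu4_runs hm hω hv hD hU h12 h23 h34 hr12 hr23 hr34 ht3 ht5 ht6 hp1 hR0 hP1x hP1y hhor
    obtain ⟨c1, c2, c3, c4, c5, c6, c7, hC1, hC2, hC3, hC4, hC5, hC6, hC7, -, H⟩ :=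
      ddduuduu4_hyp hk hm hω hv hD hU h12 h23 h34 hr12 hr23 hr34 ht3 ht5 ht6 hp1 hR0 hP1x hP1y hhor
    exact
        (ddduuduu4_eq_s4g hm hs hR0 he₁ he₂ he₃ he₄ he₅ he₆ he₇ hrun1 hrun2 hrun3 hrun4 hrun5 hrun6 hrun7 hR8 hC1 hC2
            hC3 hC4 hC5 hC6 hC7
      H rfl rfl rfl rfl rfl rfl rfl rfl rfl (ddduuduu4_int_table H)).1
  · -- `D D U D D U U U`: families A14, A15
    obtain ⟨e₁, e₂, e₃, e₄, e₅, e₆, e₇, he₁, he₂, he₃, he₄, he₅, he₆, he₇, hrun1, hrun2, hrun3, hrun4, hrun5,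
        hrun6, hrun7, hR8, -⟩ :=
      ddudduuu4_runs hm hω hv hD hU h12 h23 h34 hr12 hr23 hr34 ht2 ht3 ht5 hp1 hR0 hP1x hP1y hhor
    obtain ⟨c1, c2, c3, c4, c5, c6, c7, hC1, hC2, hC3, hC4, hC5, hC6, hC7, -, H⟩ :=
      ddudduuu4_hyp hk hm hω hv hD hU h12 h23 h34 hr12 hr23 hr34 ht2 ht3 ht5 hp1 hR0 hP1x hP1y hhor
    rcases ddudduuu4_int_table H with hF | hF
    · exact
        (ddudduuu4_eq_s4h hm hs hR0 he₁ he₂ he₃ he₄ he₅ he₆ he₇ hrun1 hrun2 hrun3 hrun4 hrun5 hrun6 hrun7 hR8 hC1 hC2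
            hC3 hC4 hC5 hC6 hC7
        H rfl rfl rfl rfl rfl rfl rfl rfl rfl hF).1
    · exact
        (ddudduuu4_eq_s4i hm hs hR0 he₁ he₂ he₃ he₄ he₅ he₆ he₇ hrun1 hrun2 hrun3 hrun4 hrun5 hrun6 hrun7 hR8 hC1 hC2
            hC3 hC4 hC5 hC6 hC7
        H rfl rfl rfl rfl rfl rfl rfl rfl rfl hF).1
  · -- `D D U U D D U U`: family B5
    obtain ⟨e₁, e₂, e₃, e₄, e₅, e₆, e₇, he₁, he₂, he₃, he₄, he₅, he₆, he₇, hrun1, hrun2, hrun3, hrun4, hrun5,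
        hrun6, hrun7, hR8, -⟩ :=
      dduudduu4_runs hm hω hv hD hU h12 h23 h34 hr12 hr23 hr34 ht2 ht4 ht6 hp1 hR0 hP1x hP1y hhor
    obtain ⟨c1, c2, c3, c4, c5, c6, c7, hC1, hC2, hC3, hC4, hC5, hC6, hC7, -, H⟩ :=
      dduudduu4_hyp hk hm hω hv hD hU h12 h23 h34 hr12 hr23 hr34 ht2 ht4 ht6 hp1 hR0 hP1x hP1y hhor
    obtain ⟨a, ha1, ha2, hwa⟩ := dduudduu4_eq_s4j hm hs hR0 he₁ he₂ he₃ he₄ he₅ he₆ he₇ hrun1 hrun2 hrun3 hrun4 hrun5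
        hrun6 hrun7 hR8 hC1 hC2 hC3 hC4 hC5 hC6 hC7
      H rfl rfl rfl rfl rfl rfl rfl rfl rfl (dduudduu4_int_table H)
    rw [hwa]
    exact s4j_mem_ddddBlocks ha1 ha2

/-- ★★★ **The exact four-down law at slack four.** For `k ≥ 2`, exactly `(k−2)(2k⁴ − 7k³ + 4k² + 7k + 6)/12`
irreducible positive wall bridges of length `6k + 4` with `k` surface visits have exactly four down steps
(`= 0, 3, 27, 129, 424, 1105, 2463, 4907, 8984` for `k = 2, …, 10`; the lane's enumeration agrees for `k ≤ 8`; the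
right side is written truncation-safely, `2k⁴ + 4k² + 7k + 6 ≥ 7k³`). Upper bound: the classification
`four_down_mem_ddddBlocks` and `twelve_mul_card_ddddBlocks`; lower bound:
`le_twelve_mul_card_filter_visits_four_down` (`…SlackFourFourDownCount`). OURS.
[cite: MadrasSlade1993, §4.2, Definition 4.2.1 (p. 90), (4.2.2)]
[cite: BeatonBousquetMelouDeGierDuminilCopinGuttmann2014, §3.1] [cite: EntingJensen2009, §7.4.2, Fig. 7.10] -/
theorem twelve_mul_card_filter_visits_four_down {k m : ℕ} (hk : 2 ≤ k) (hm : m = 6 * k + 4) :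
    12 * #((ipwb m).filter fun ω => visits m ω = k ∧ #(stepsD m ω) = 4) =
      (k - 2) * (2 * k ^ 4 + 4 * k ^ 2 + 7 * k + 6 - 7 * k ^ 3) := by
  classical
  refine le_antisymm ?_ (le_twelve_mul_card_filter_visits_four_down hm)
  rw [← twelve_mul_card_ddddBlocks k]
  exact Nat.mul_le_mul_left 12 (card_le_card fun w hw => by
    rw [mem_filter] at hw
    exact four_down_mem_ddddBlocks hk hm hw.1 hw.2.1 hw.2.2)

/-- ★★★★ **The exact slack-four row of the surface renewal table.** For `k ≥ 2`, the number `N(6k+4, k)` of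
irreducible positive wall bridges of length `6k + 4` with `k` surface visits satisfies
`12 · N = 2k⁵ − 11k⁴ + 30k³ + 5k² − 38k + 60` (written truncation-safely),
`N = 11, 33, 95, 260, 649, 1461, 2993, 5643, 9934` for `k = 2, …, 10` — the lane's enumeration agrees for
`k ≤ 8`. From the exact four-down law and `two_mul_card_filter_visits_slack_four` (`…SlackFourRow`: the strata
with two and three down steps, none with fewer or more). The floor `slack_four_quintic_floor` of
`…SlackFourFourDownCount` is thereby an equality: the fourth exact row, after `N(6k, k) = 1`-type rows of slack
zero and two, of the renewal structure behind the critical surface fugacity `1 + √2`. OURS.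
[cite: MadrasSlade1993, §4.2, Definition 4.2.1 (p. 90), (4.2.2)]
[cite: BeatonBousquetMelouDeGierDuminilCopinGuttmann2014, §3.1] [cite: EntingJensen2009, §7.4.2, Fig. 7.10] -/
theorem twelve_mul_card_filter_visits_slack_four {k m : ℕ} (hk : 2 ≤ k) (hm : m = 6 * k + 4) :
    12 * #((ipwb m).filter fun ω => visits m ω = k) = 2 * k ^ 5 + 30 * k ^ 3 + 5 * k ^ 2 + 60 - (11 * k ^ 4 + 38 * k)
        := by
  have hrow := two_mul_card_filter_visits_slack_four hk hm
  have h4 := twelve_mul_card_filter_visits_four_down hk hm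
  obtain ⟨n, rfl⟩ : ∃ n, k = n + 2 := ⟨k - 2, by omega⟩
  have e1 : n + 2 - 2 = n := by omega
  have e2 : n + 2 - 1 = n + 1 := by omega
  have e3 : 2 * (n + 2) ^ 4 + 4 * (n + 2) ^ 2 + 7 * (n + 2) + 6 - 7 * (n + 2) ^ 3 =
      2 * n ^ 4 + 9 * n ^ 3 + 10 * n ^ 2 + 3 * n + 12 := by
    have : 2 * (n + 2) ^ 4 + 4 * (n + 2) ^ 2 + 7 * (n + 2) + 6 =
        7 * (n + 2) ^ 3 + (2 * n ^ 4 + 9 * n ^ 3 + 10 * n ^ 2 + 3 * n + 12) := by ring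
    omega
  have e4 : 2 * (n + 2) * (n + 2) + 3 * (n + 2) - 4 = 2 * n ^ 2 + 11 * n + 10 := by
    have : 2 * (n + 2) * (n + 2) + 3 * (n + 2) = 4 + (2 * n ^ 2 + 11 * n + 10) := by ring
    omega
  have e5 : 2 * (n + 2) ^ 5 + 30 * (n + 2) ^ 3 + 5 * (n + 2) ^ 2 + 60 - (11 * (n + 2) ^ 4 + 38 * (n + 2)) =
      2 * n ^ 5 + 9 * n ^ 4 + 22 * n ^ 3 + 81 * n ^ 2 + 150 * n + 132 := by
    have : 2 * (n + 2) ^ 5 + 30 * (n + 2) ^ 3 + 5 * (n + 2) ^ 2 + 60 =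
        11 * (n + 2) ^ 4 + 38 * (n + 2) + (2 * n ^ 5 + 9 * n ^ 4 + 22 * n ^ 3 + 81 * n ^ 2 + 150 * n + 132) := by ring
    omega
  rw [e1, e3] at h4
  rw [e2, e4] at hrow
  rw [e5]
  zify at hrow h4 ⊢
  linear_combination 6 * hrow + h4

end Literature.Probability.RandomPlanarGeometry.SAW.HexBW.Wall
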